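import Mathlib
import Literature.AlgebraicGeometry.Resolution.LocalBlowup
import Literature.AlgebraicGeometry.Resolution.TranscendenceDefect
import Literature.RingTheory.KrullDimension.AffineDimension
import Literature.RingTheory.KrullDimension.LocalizationDimension
import Literature.AlgebraicGeometry.Resolution.AffineDomainEquidim
import Literature.AlgebraicGeometry.Resolution.ExcellentRingsFieldProofs
import Literature.AlgebraicGeometry.Resolution.ExcellentRingsEssFiniteType
import Literature.AlgebraicGeometry.Resolution.LocalBlowupModels
import Literature.AlgebraicGeometry.Resolution.QuadraticTransformsRegular
import Summits.ResolutionOfSingularities.ResolutionOfSingularities.Theorems.RadicialJungCleanModelsCleanLU3ArcPackage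
import Summits.ResolutionOfSingularities.ResolutionOfSingularities.Theorems.RadicialJungCleanModelsLens5RegularityCriterion
import Summits.ResolutionOfSingularities.ResolutionOfSingularities.Theorems.RadicialJungCleanModelsLens5ChartSurjection
import Summits.ResolutionOfSingularities.ResolutionOfSingularities.Theorems.RadicialJungCleanModelsLens5PRankTwoCurrency
import HarnessLib

/-!
# PORT (T-slice module map §16 (vii), part 4a) of res-B-lens-5's `Lens5_PRankTwoAssembly.lean` rev 7: PORT 4 plumbing — the normal-form predicate
# `NF R w x` («some power of `w` multiplies `x` into `R`») with its closure lemmas, `zpow` membership helpers, and the three regularity-kit lemmas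
# of the assembly's in-file copy that are not in ✓ `…Lens5RegularityCriterion` (`natCast_sub_le_ringKrullDim_quotient{,_span}`,
# `localization_mvPolynomial_regular_of_surjective`)

Author res-B-lens-5 (g10); ported verbatim by res-B-lead-1 g5.  This file DECLARES A DEFINITION (`NF`, verbatim) ⇒ review lane.  OURS; nothing here
proves resolution in characteristic `p`.
-/

noncomputable section

set_option linter.dupNamespace false -- mandated namespace of this single-conjunct summit

open IsLocalRing
open Literature.AlgebraicGeometry.Resolution
open Summit.ResolutionOfSingularities.ResolutionOfSingularities.Theorems.RadicialJungCleanModels.Lens5RegularityCriterion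
open Summit.ResolutionOfSingularities.ResolutionOfSingularities.Theorems.RadicialJungCleanModels.Lens5ChartSurjection
open Summit.ResolutionOfSingularities.ResolutionOfSingularities.Theorems.RadicialJung.CleanModels.Lens5.PRankTwoCurrency

namespace Summit.ResolutionOfSingularities.ResolutionOfSingularities.Theorems.RadicialJung.CleanModels.Lens5.PRankTwoAssembly

/-- Krull: `dim S − ρ ≤ dim (S ⧸ 𝔞)` for an ideal `𝔞 ⊆ 𝔪_S` generated by `≤ ρ` elements (res-B-lens-5, regularity-criterion kit). [folklore] -/
theorem natCast_sub_le_ringKrullDim_quotient {S : Type} [CommRing S] [IsLocalRing S] [IsNoetherianRing S] {n ρ : ℕ}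
    (hdim : ringKrullDim S = n) (𝔞 : Ideal S) (h𝔞m : 𝔞 ≤ maximalIdeal S) (hgen : 𝔞.spanFinrank ≤ ρ) :
    ((n - ρ : ℕ) : WithBot ℕ∞) ≤ ringKrullDim (S ⧸ 𝔞) := by
  classical
  have h𝔞top : 𝔞 ≠ ⊤ := fun h => (maximalIdeal.isMaximal S).ne_top (top_le_iff.mp (h ▸ h𝔞m))
  haveI : Nontrivial (S ⧸ 𝔞) := Ideal.Quotient.nontrivial_iff.mpr h𝔞top
  have hKrull : ringKrullDim S ≤ ringKrullDim (S ⧸ 𝔞) + 𝔞.spanFinrank :=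
    ringKrullDim_le_ringKrullDim_quotient_add_spanFinrank 𝔞 (le_jacobson_of_le_maximalIdeal 𝔞 h𝔞m)
  have hQle : ringKrullDim (S ⧸ 𝔞) ≤ (n : WithBot ℕ∞) := hdim ▸ ringKrullDim_le_of_surjective _ Ideal.Quotient.mk_surjective
  have hQbot : ringKrullDim (S ⧸ 𝔞) ≠ ⊥ := by
    have h0 : (0 : WithBot ℕ∞) ≤ ringKrullDim (S ⧸ 𝔞) := ringKrullDim_nonneg_of_nontrivial
    intro h
    rw [h] at h0
    exact absurd h0 (by simp)
  obtain ⟨m, hm⟩ := exists_nat_eq_of_le_nat _ hQbot n hQle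
  have hnm : n ≤ m + ρ := by
    rw [hdim, hm] at hKrull
    have h' : (n : WithBot ℕ∞) ≤ (m : WithBot ℕ∞) + (ρ : WithBot ℕ∞) :=
      hKrull.trans (add_le_add le_rfl (by exact_mod_cast hgen))
    have h'' : ((n : ℕ) : WithBot ℕ∞) ≤ ((m + ρ : ℕ) : WithBot ℕ∞) := by push_cast; exact h'
    exact_mod_cast h''
  rw [hm]; exact_mod_cast (by omega : n - ρ ≤ m)

/-- The same for `𝔞 = (u₁, …, u_ρ)`, `uᵢ ∈ 𝔪_S`. [folklore] -/
theorem natCast_sub_le_ringKrullDim_quotient_span {S : Type} [CommRing S] [IsLocalRing S] [IsNoetherianRing S] {n ρ : ℕ}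
    (hdim : ringKrullDim S = n) (u : Fin ρ → S) (hu : ∀ i, u i ∈ maximalIdeal S) :
    ((n - ρ : ℕ) : WithBot ℕ∞) ≤ ringKrullDim (S ⧸ Ideal.span (Set.range u)) := by
  classical
  refine natCast_sub_le_ringKrullDim_quotient hdim (Ideal.span (Set.range u)) ?_ ?_
  · rw [Ideal.span_le]
    rintro _ ⟨i, rfl⟩
    exact hu i
  · have hr : Set.range u = ((Finset.univ.image u : Finset S) : Set S) := by ext; simp
    rw [hr]
    refine (Submodule.spanFinrank_span_le_ncard_of_finite (R := S) (Finset.finite_toSet _)).trans ?_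
    rw [Set.ncard_coe_finset]
    exact Finset.card_image_le.trans (by simp)

/-- **THE REGULARITY CRITERION (§4′), abstract ideal** (kit `regular_of_regular_quotient'`, verbatim).  `S` Noetherian local of dimension
`n`; `𝔞 ⊆ 𝔪_S` generated by `≤ ρ` elements (`ρ ≤ n`); `P` a regular local domain of dimension `n − ρ` with a surjection `f : P ↠ S ⧸ 𝔞`.
Then `S` is regular, `f` is injective, the maximal ideal of the quotient is `f(𝔪_P)` and is the image of `𝔪_S`, and the lift of a
regular parameter of `P` is a regular parameter of `S`. [folklore] -/

theorem localization_mvPolynomial_regular_of_surjective (κ : Type) [Field κ] (m : ℕ) (𝔫 : Ideal (MvPolynomial (Fin m) κ))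
    [𝔫.IsPrime] {E : Type} [CommRing E] (f : Localization.AtPrime 𝔫 →+* E) (hf : Function.Surjective f)
    (hE : (m : WithBot ℕ∞) ≤ ringKrullDim E) :
    IsRegularLocalRing (Localization.AtPrime 𝔫) ∧ IsDomain (Localization.AtPrime 𝔫) ∧
      ringKrullDim (Localization.AtPrime 𝔫) = m := by
  refine ⟨inferInstance, inferInstance, le_antisymm ?_ (hE.trans (ringKrullDim_le_of_surjective f hf))⟩
  calc ringKrullDim (Localization.AtPrime 𝔫) ≤ ringKrullDim (MvPolynomial (Fin m) κ) :=
        Literature.RingTheory.KrullDimension.ringKrullDim_localization_atPrime_le 𝔫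
    _ = m := by
        rw [MvPolynomial.ringKrullDim_of_isNoetherianRing, ringKrullDim_eq_zero_of_field]
        simp

/-! ### (rev 4) PORT 4 plumbing: normal forms `x · w ^ N ∈ R₀` (clearing the value-zero chart monomials) -/

/-- `NF R w x`: some power of `w` multiplies `x` into the subring `R` (port: `R = T[u]`, `w = ∏_{j ≥ ρ} u_j`). -/
def NF {K : Type} [Field K] (R : Subring K) (w x : K) : Prop := ∃ N : ℕ, x * w ^ N ∈ R

namespace NF

variable {K : Type} [Field K] {R : Subring K} {w : K}

/-- Elements of `R` are in normal form (`N = 0`). [folklore] -/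
theorem of_mem {x : K} (hx : x ∈ R) : NF R w x := ⟨0, by simpa using hx⟩

/-- `0` is in normal form. [folklore] -/
theorem zero : NF R w 0 := of_mem R.zero_mem

/-- `1` is in normal form. [folklore] -/
theorem one : NF R w 1 := of_mem R.one_mem

/-- Normal forms are closed under addition (`w ∈ R`). [folklore] -/
theorem add {x y : K} (hw : w ∈ R) (hx : NF R w x) (hy : NF R w y) : NF R w (x + y) := by
  obtain ⟨a, ha⟩ := hx
  obtain ⟨b, hb⟩ := hy
  refine ⟨a + b, ?_⟩
  have h : (x + y) * w ^ (a + b) = x * w ^ a * w ^ b + y * w ^ b * w ^ a := by ring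
  rw [h]
  exact R.add_mem (R.mul_mem ha (R.pow_mem hw b)) (R.mul_mem hb (R.pow_mem hw a))

/-- Normal forms are closed under multiplication. [folklore] -/
theorem mul {x y : K} (hx : NF R w x) (hy : NF R w y) : NF R w (x * y) := by
  obtain ⟨a, ha⟩ := hx
  obtain ⟨b, hb⟩ := hy
  refine ⟨a + b, ?_⟩
  have h : x * y * w ^ (a + b) = (x * w ^ a) * (y * w ^ b) := by ring
  rw [h]
  exact R.mul_mem ha hb

/-- Normal forms are closed under powers. [folklore] -/
theorem pow {x : K} (hx : NF R w x) (n : ℕ) : NF R w (x ^ n) := by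
  induction n with
  | zero => rw [pow_zero]; exact one
  | succ n ih => rw [pow_succ]; exact ih.mul hx

/-- Normal forms are closed under finite sums (`w ∈ R`). [folklore] -/
theorem sum {ι : Type} (s : Finset ι) (f : ι → K) (hw : w ∈ R) (h : ∀ i ∈ s, NF R w (f i)) :
    NF R w (∑ i ∈ s, f i) :=
  Finset.sum_induction f (NF R w) (fun _ _ ha hb => ha.add hw hb) zero h

/-- Normal forms are closed under finite products. [folklore] -/
theorem prod {ι : Type} (s : Finset ι) (f : ι → K) (h : ∀ i ∈ s, NF R w (f i)) : NF R w (∏ i ∈ s, f i) :=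
  Finset.prod_induction f (NF R w) (fun _ _ ha hb => ha.mul hb) one h

/-- Normal forms of `x` and `x⁻¹` give normal forms of all integer powers. [folklore] -/
theorem zpow {x : K} (hx : NF R w x) (hxi : NF R w x⁻¹) (n : ℤ) : NF R w (x ^ n) := by
  obtain ⟨m, rfl | rfl⟩ := Int.eq_nat_or_neg n
  · rw [zpow_natCast]; exact hx.pow m
  · rw [zpow_neg, zpow_natCast, ← inv_pow]; exact hxi.pow m

/-- Non-negative integer powers of a normal form are normal forms. [folklore] -/
theorem zpow_of_nonneg {x : K} (hx : NF R w x) {n : ℤ} (hn : 0 ≤ n) : NF R w (x ^ n) := by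
  obtain ⟨m, rfl⟩ := Int.eq_ofNat_of_zero_le hn
  rw [zpow_natCast]; exact hx.pow m

end NF

/-- Non-negative integer powers stay in a subring. [folklore] -/
theorem zpow_mem_of_nonneg {K : Type} [Field K] {B : Subring K} {a : K} (ha : a ∈ B) {n : ℤ} (hn : 0 ≤ n) : a ^ n ∈ B := by
  obtain ⟨m, rfl⟩ := Int.eq_ofNat_of_zero_le hn
  rw [zpow_natCast]; exact pow_mem ha m

/-- Integer powers of an element whose inverse is also in the subring stay in the subring. [folklore] -/
theorem zpow_mem_of_inv_mem {K : Type} [Field K] {B : Subring K} {a : K} (ha : a ∈ B) (hai : a⁻¹ ∈ B) (n : ℤ) : a ^ n ∈ B := by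
  obtain ⟨m, rfl | rfl⟩ := Int.eq_nat_or_neg n
  · rw [zpow_natCast]; exact pow_mem ha m
  · rw [zpow_neg, zpow_natCast, ← inv_pow]; exact pow_mem hai m


end Summit.ResolutionOfSingularities.ResolutionOfSingularities.Theorems.RadicialJung.CleanModels.Lens5.PRankTwoAssembly

end
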